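import Mathlib
import Literature.MathematicalPhysics.QuantumLattice.Imbrie2016.FlagDuality

/-!
# Up-variation dominates every partial net climb  [folklore]

For the flag functional `upVar n f = ∑_{k < n-1} (f (k+1) - f k)⁺` of
`Literature.MathematicalPhysics.QuantumLattice.Imbrie2016.FlagDuality` we record the
interval version of `net_le_upVar`: for all positions `i ≤ j ≤ n - 1`,
`f j - f i ≤ upVar n f`, together with `0 ≤ upVar n f`.

This is the inequality behind the "first/last atom" lower bounds for the minimal
up-variation over flags (repair cell b2b-imbrie, seat 2, DENSITY-XY G.56 THEOREM H and
G.58(d)): the total climb of a flag is at least the level difference between any later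
and any earlier position.  Elementary telescoping; tagged folklore.
-/

open Finset

namespace Literature.MathematicalPhysics.QuantumLattice.Imbrie2016

/-- [folklore] Telescoping with positive parts: `f j - f i ≤ ∑_{k ∈ [i,j)} (f (k+1) - f k)⁺`. -/
theorem sub_le_sum_Ico_posPart (f : ℕ → ℝ) {i j : ℕ} (hij : i ≤ j) :
    f j - f i ≤ ∑ k ∈ Ico i j, max (f (k + 1) - f k) 0 := by
  induction j, hij using Nat.le_induction with
  | base => simp
  | succ j hj ih =>
      rw [Finset.sum_Ico_succ_top hj]
      have h1 : f (j + 1) - f j ≤ max (f (j + 1) - f j) 0 := le_max_left _ _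
      linarith

/-- [folklore] The up-variation is nonnegative. -/
theorem upVar_nonneg (n : ℕ) (f : ℕ → ℝ) : 0 ≤ upVar n f := by
  unfold upVar
  exact Finset.sum_nonneg (fun k _ => le_max_right _ _)

/-- [folklore] Interval version of `net_le_upVar`: the up-variation of a flag dominates the net
level change between ANY two positions `i ≤ j ≤ n - 1`. -/
theorem sub_le_upVar (n : ℕ) (f : ℕ → ℝ) {i j : ℕ} (hij : i ≤ j) (hjn : j + 1 ≤ n) :
    f j - f i ≤ upVar n f := by
  have h1 := sub_le_sum_Ico_posPart f hij
  have h2 : ∑ k ∈ Ico i j, max (f (k + 1) - f k) 0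
      ≤ ∑ k ∈ range (n - 1), max (f (k + 1) - f k) 0 := by
    apply Finset.sum_le_sum_of_subset_of_nonneg
    · intro k hk
      simp only [Finset.mem_Ico] at hk
      simp only [Finset.mem_range]
      omega
    · intro k _ _
      exact le_max_right _ _
  unfold upVar
  linarith

/-- [folklore] In particular a flag whose level at some position `j` exceeds its level at an
earlier position `i` by `t` has up-variation at least `t` (the "dip exit" bound). -/
theorem le_upVar_of_climb (n : ℕ) (f : ℕ → ℝ) {i j : ℕ} (hij : i ≤ j) (hjn : j + 1 ≤ n)
    {t : ℝ} (ht : t ≤ f j - f i) : t ≤ upVar n f :=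
  le_trans ht (sub_le_upVar n f hij hjn)

end Literature.MathematicalPhysics.QuantumLattice.Imbrie2016
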